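import Summits.AtomisticToContinuum.FouriersLaw.Theorems.HiddenChargeMazurNoOddChargeDefs

/-!
# No odd small-range charges for the pinned anharmonic chain — list polynomials

Support file for item `stmt-AtomisticToContinuum-13514` (`HiddenChargeMazur.NoOddChargeSmallRange`):
every momentum-odd polynomial 3-site density of degree `≤ 4` with a local conservation law of the infinite
pinned anharmonic chain is a coboundary `h ∘ shift − h` (this algebraic half), hence has sub-extensive current
overlap (the analytic half).

Evaluation and coordinate derivatives of list polynomials, homogeneity, completeness and duplicate-freeness
of `allExps`, the flat representation of an `MvPolynomial` of total degree `≤ B` (`eval_eq_evalList`), and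
sparse multivariate coefficient extraction (`rl_extract`: if `∑ a_e x^e = 0` for all real `x` then all `a_e = 0`).
-/

noncomputable section

open scoped BigOperators
open Literature.MathematicalPhysics.KineticTheory.HeatConduction

namespace Summit.AtomisticToContinuum.FouriersLaw.Theorems.NoOddCharge

/-! ## Part A: list polynomials -/


/-- [folklore] -/
@[simp] theorem evalList_nil {n : ℕ} {κ : Type*} (c : κ → ℝ) (v : Fin n → ℝ) :
    evalList ([] : List ((Fin n → ℕ) × κ)) c v = 0 := rfl

/-- [folklore] -/
@[simp] theorem evalList_cons {n : ℕ} {κ : Type*} (ek : (Fin n → ℕ) × κ) (L : List ((Fin n → ℕ) × κ))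
    (c : κ → ℝ) (v : Fin n → ℝ) :
    evalList (ek :: L) c v = c ek.2 * ∏ i, v i ^ ek.1 i + evalList L c v := rfl

/-- [folklore] -/
theorem evalList_append {n : ℕ} {κ : Type*} (L L' : List ((Fin n → ℕ) × κ)) (c : κ → ℝ) (v : Fin n → ℝ) :
    evalList (L ++ L') c v = evalList L c v + evalList L' c v := by
  simp [evalList, List.map_append, List.sum_append]


/-- `t ↦ ∏ (update v j t)_i^{e_i}` has derivative `dmono j e v` at `t = v j`. [folklore] -/
theorem hasDerivAt_mono {n : ℕ} (j : Fin n) (e : Fin n → ℕ) (v : Fin n → ℝ) :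
    HasDerivAt (fun t => ∏ i, (Function.update v j t) i ^ e i) (dmono j e v) (v j) := by
  classical
  have hsplit : ∀ t, (∏ i, (Function.update v j t) i ^ e i) =
      t ^ e j * ∏ i ∈ Finset.univ.erase j, v i ^ e i := by
    intro t
    rw [← Finset.mul_prod_erase _ _ (Finset.mem_univ j)]
    congr 1
    · simp
    · refine Finset.prod_congr rfl fun i hi => ?_
      rw [Function.update_of_ne (Finset.ne_of_mem_erase hi)]
  have hd : HasDerivAt (fun t : ℝ => t ^ e j * ∏ i ∈ Finset.univ.erase j, v i ^ e i)
      (((e j : ℝ) * v j ^ (e j - 1)) * ∏ i ∈ Finset.univ.erase j, v i ^ e i) (v j) :=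
    (hasDerivAt_pow (e j) (v j)).mul_const _
  have heq : ((e j : ℝ) * v j ^ (e j - 1)) * ∏ i ∈ Finset.univ.erase j, v i ^ e i = dmono j e v := by
    unfold dmono
    rw [← Finset.mul_prod_erase _ _ (Finset.mem_univ j)]
    simp only [if_true]
    rw [mul_assoc]
    congr 2
    refine Finset.prod_congr rfl fun i hi => ?_
    rw [if_neg (Finset.ne_of_mem_erase hi)]
  rw [← heq]
  exact hd.congr_of_eventuallyEq (Filter.Eventually.of_forall fun t => hsplit t)


/-- [folklore] -/
@[simp] theorem devalList_nil {n : ℕ} {κ : Type*} (j : Fin n) (c : κ → ℝ) (v : Fin n → ℝ) :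
    devalList j ([] : List ((Fin n → ℕ) × κ)) c v = 0 := rfl

/-- [folklore] -/
@[simp] theorem devalList_cons {n : ℕ} {κ : Type*} (j : Fin n) (ek : (Fin n → ℕ) × κ)
    (L : List ((Fin n → ℕ) × κ)) (c : κ → ℝ) (v : Fin n → ℝ) :
    devalList j (ek :: L) c v = c ek.2 * dmono j ek.1 v + devalList j L c v := rfl

/-- [folklore] -/
theorem devalList_append {n : ℕ} {κ : Type*} (j : Fin n) (L L' : List ((Fin n → ℕ) × κ)) (c : κ → ℝ)
    (v : Fin n → ℝ) : devalList j (L ++ L') c v = devalList j L c v + devalList j L' c v := by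
  simp [devalList, List.map_append, List.sum_append]

/-- `t ↦ evalList L c (update v j t)` has derivative `devalList j L c v` at `t = v j`. [folklore] -/
theorem hasDerivAt_evalList {n : ℕ} {κ : Type*} (j : Fin n) (L : List ((Fin n → ℕ) × κ)) (c : κ → ℝ)
    (v : Fin n → ℝ) :
    HasDerivAt (fun t => evalList L c (Function.update v j t)) (devalList j L c v) (v j) := by
  induction L with
  | nil => simpa [evalList] using hasDerivAt_const (v j) (0 : ℝ)
  | cons ek L ih =>
    simp only [evalList_cons, devalList_cons]
    exact ((hasDerivAt_mono j ek.1 v).const_mul (c ek.2)).add ih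

/-- [folklore] -/
theorem deriv_evalList {n : ℕ} {κ : Type*} (j : Fin n) (L : List ((Fin n → ℕ) × κ)) (c : κ → ℝ)
    (v : Fin n → ℝ) :
    deriv (fun t => evalList L c (Function.update v j t)) (v j) = devalList j L c v :=
  (hasDerivAt_evalList j L c v).deriv

/-- Homogeneity of the derivative monomial: `dmono j e (s • v) = s^(|e| - 1) dmono j e v`. [folklore] -/
theorem dmono_smul {n : ℕ} (j : Fin n) (e : Fin n → ℕ) (s : ℝ) (v : Fin n → ℝ) :
    dmono j e (fun i => s * v i) = s ^ ((∑ i, e i) - 1) * dmono j e v := by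
  classical
  unfold dmono
  by_cases hj : e j = 0
  · simp [hj]
  · have hsum : (∑ i, (if i = j then e j - 1 else e i)) = (∑ i, e i) - 1 := by
      have h1 : (∑ i, (if i = j then e j - 1 else e i)) + 1 = ∑ i, e i := by
        rw [← Finset.add_sum_erase _ _ (Finset.mem_univ j), ← Finset.add_sum_erase _ e (Finset.mem_univ j)]
        simp only [if_true]
        have : ∑ i ∈ Finset.univ.erase j, (if i = j then e j - 1 else e i) = ∑ i ∈ Finset.univ.erase j, e i :=
          Finset.sum_congr rfl fun i hi => by rw [if_neg (Finset.ne_of_mem_erase hi)]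
        rw [this]; omega
      omega
    rw [← hsum]
    simp_rw [mul_pow, Finset.prod_mul_distrib, Finset.prod_pow_eq_pow_sum]
    ring

/-- Homogeneity of `devalList` on a table of constant degree `d`. [folklore] -/
theorem devalList_smul {n : ℕ} {κ : Type*} (j : Fin n) (L : List ((Fin n → ℕ) × κ)) (c : κ → ℝ) {d : ℕ}
    (hL : ∀ ek ∈ L, (∑ i, ek.1 i) = d) (s : ℝ) (v : Fin n → ℝ) :
    devalList j L c (fun i => s * v i) = s ^ (d - 1) * devalList j L c v := by
  induction L with
  | nil => simp
  | cons ek L ih =>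
    simp only [devalList_cons]
    rw [ih (fun ek' h => hL ek' (List.mem_cons_of_mem _ h)), dmono_smul, hL ek List.mem_cons_self]
    ring


/-! ### Exponent enumeration and the flat representation of low-degree polynomials -/


/-- Completeness of `allExps`: every exponent vector of weight `≤ B` is listed. [folklore] -/
theorem mem_allExps : ∀ (n B : ℕ) (e : Fin n → ℕ), (∑ i, e i) ≤ B → e ∈ allExps n B
  | 0, B, e, _ => by
    have : e = Fin.elim0 := funext fun i => Fin.elim0 i
    simp [allExps, this]
  | n + 1, B, e, he => by
    rw [Fin.sum_univ_succ] at he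
    have h0 : e 0 ≤ B := le_trans (Nat.le_add_right _ _) he
    have htail : (∑ i, Fin.tail e i) ≤ B - e 0 := by
      have : (∑ i : Fin n, e i.succ) = ∑ i, Fin.tail e i := rfl
      omega
    have ih := mem_allExps n (B - e 0) (Fin.tail e) htail
    simp only [allExps, List.mem_flatMap, List.mem_range, List.mem_map]
    exact ⟨e 0, Nat.lt_succ_of_le h0, Fin.tail e, ih, Fin.cons_self_tail e⟩

/-- `allExps n B` has no duplicates. [folklore] -/
theorem nodup_allExps : ∀ (n B : ℕ), (allExps n B).Nodup
  | 0, B => by simp [allExps]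
  | n + 1, B => by
    simp only [allExps]
    rw [List.nodup_flatMap]
    refine ⟨fun a _ => (nodup_allExps n (B - a)).map (Fin.cons_right_injective (α := fun _ => ℕ) a), ?_⟩
    refine List.Nodup.pairwise_of_forall_ne List.nodup_range ?_
    intro a _ b _ hab
    simp only [Function.onFun, List.disjoint_left, List.mem_map]
    rintro f ⟨t, _, rfl⟩ ⟨t', _, h⟩
    have := congrFun h 0
    simp only [Fin.cons_zero] at this
    exact hab this.symm

/-- **Flat representation.** A polynomial of total degree `≤ B` in `n` variables evaluates to the list
polynomial over `allExps n B` (keyed by the exponent itself) with its own coefficients. [folklore] -/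
theorem eval_eq_evalList {n B : ℕ} (p : MvPolynomial (Fin n) ℝ) (hp : p.totalDegree ≤ B) (v : Fin n → ℝ) :
    MvPolynomial.eval v p =
      evalList ((allExps n B).map fun e => (e, e)) (fun e => p.coeff (Finsupp.equivFunOnFinite.symm e)) v := by
  classical
  set φ : (Fin n → ℕ) ≃ (Fin n →₀ ℕ) := Finsupp.equivFunOnFinite.symm with hφ
  have hnd := nodup_allExps n B
  have hL : evalList ((allExps n B).map fun e => (e, e)) (fun e => p.coeff (φ e)) v =
      ((allExps n B).map fun e => p.coeff (φ e) * ∏ i, v i ^ e i).sum := by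
    simp [evalList, List.map_map, Function.comp_def]
  rw [hL, ← List.sum_toFinset _ hnd, MvPolynomial.eval_eq']
  have hre : ∑ e ∈ (allExps n B).toFinset, p.coeff (φ e) * ∏ i, v i ^ e i =
      ∑ d ∈ (allExps n B).toFinset.map φ.toEmbedding, p.coeff d * ∏ i, v i ^ d i := by
    rw [Finset.sum_map]
    rfl
  rw [hre]
  refine Finset.sum_subset ?_ ?_
  · intro d hd
    rw [Finset.mem_map]
    refine ⟨φ.symm d, ?_, by simp⟩
    rw [List.mem_toFinset]
    apply mem_allExps
    have h1 := MvPolynomial.le_totalDegree hd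
    have h2 : (d.sum fun _ k => k) = ∑ i, d i := by
      rw [Finsupp.sum_fintype]; intro; rfl
    have h3 : (∑ i, (φ.symm d) i) = ∑ i, d i := by
      refine Finset.sum_congr rfl fun i _ => ?_
      simp [hφ]
    omega
  · intro d _ hd
    rw [MvPolynomial.notMem_support_iff.mp hd, zero_mul]

/-! ## Part C3: sparse multivariate coefficient extraction -/


/-- [folklore] -/
@[simp] theorem rlEval_nil {m : ℕ} (x : Fin m → ℝ) : rlEval ([] : List ((Fin m → ℕ) × ℝ)) x = 0 := rfl

/-- [folklore] -/
@[simp] theorem rlEval_cons {m : ℕ} (ea : (Fin m → ℕ) × ℝ) (RL : List ((Fin m → ℕ) × ℝ)) (x : Fin m → ℝ) :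
    rlEval (ea :: RL) x = ea.2 * ∏ i, x i ^ ea.1 i + rlEval RL x := rfl
/-- Technical step `eval_rlPoly` (list polynomials). [folklore] -/


theorem eval_rlPoly {m : ℕ} (RL : List ((Fin m → ℕ) × ℝ)) (x : Fin m → ℝ) :
    MvPolynomial.eval x (rlPoly RL) = rlEval RL x := by
  induction RL with
  | nil => simp [rlPoly, rlEval]
  | cons ea RL ih =>
    simp only [rlPoly, List.map_cons, List.sum_cons, map_add, rlEval_cons] at ih ⊢
    rw [← ih]
    congr 1
    rw [MvPolynomial.eval_monomial, Finsupp.prod_fintype _ _ (fun i => by simp)]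
    simp
/-- Technical step `coeff_rlPoly_of_not_mem` (list polynomials). [folklore] -/

theorem coeff_rlPoly_of_not_mem {m : ℕ} (RL : List ((Fin m → ℕ) × ℝ)) (e : Fin m → ℕ)
    (he : e ∉ RL.map Prod.fst) :
    MvPolynomial.coeff (Finsupp.equivFunOnFinite.symm e) (rlPoly RL) = 0 := by
  induction RL with
  | nil => simp [rlPoly]
  | cons ea RL ih =>
    simp only [List.map_cons, List.mem_cons, not_or] at he
    simp only [rlPoly, List.map_cons, List.sum_cons, MvPolynomial.coeff_add] at ih ⊢
    rw [ih he.2, MvPolynomial.coeff_monomial, if_neg, zero_add]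
    intro h
    exact he.1 (Finsupp.equivFunOnFinite.symm.injective h).symm
/-- Technical step `coeff_rlPoly_of_mem` (list polynomials). [folklore] -/

theorem coeff_rlPoly_of_mem {m : ℕ} (RL : List ((Fin m → ℕ) × ℝ)) (hnd : (RL.map Prod.fst).Nodup)
    {ea : (Fin m → ℕ) × ℝ} (hea : ea ∈ RL) :
    MvPolynomial.coeff (Finsupp.equivFunOnFinite.symm ea.1) (rlPoly RL) = ea.2 := by
  induction RL with
  | nil => simp at hea
  | cons ea' RL ih =>
    simp only [List.map_cons, List.nodup_cons] at hnd
    simp only [rlPoly, List.map_cons, List.sum_cons, MvPolynomial.coeff_add]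
    rcases List.mem_cons.mp hea with h | h
    · subst h
      rw [MvPolynomial.coeff_monomial, if_pos rfl]
      have := coeff_rlPoly_of_not_mem RL ea.1 hnd.1
      simp only [rlPoly] at this
      rw [this, add_zero]
    · have hne : ea'.1 ≠ ea.1 := fun h' => hnd.1 (h' ▸ List.mem_map_of_mem h)
      rw [MvPolynomial.coeff_monomial, if_neg (fun h' => hne (Finsupp.equivFunOnFinite.symm.injective h')),
        zero_add]
      have := ih hnd.2 h
      simpa [rlPoly] using this

/-- **Sparse coefficient extraction.** If `∑ a_e x^e = 0` for all real `x` (distinct exponents), all `a_e = 0`. [folklore] -/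
theorem rl_extract {m : ℕ} (RL : List ((Fin m → ℕ) × ℝ)) (hnd : (RL.map Prod.fst).Nodup)
    (h : ∀ x : Fin m → ℝ, rlEval RL x = 0) : ∀ ea ∈ RL, ea.2 = 0 := by
  have hP : rlPoly RL = 0 := by
    apply MvPolynomial.funext
    intro x
    rw [eval_rlPoly, h x, map_zero]
  intro ea hea
  rw [← coeff_rlPoly_of_mem RL hnd hea, hP, MvPolynomial.coeff_zero]

end Summit.AtomisticToContinuum.FouriersLaw.Theorems.NoOddCharge

end
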